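import Summits.NavierStokesRegularity.FluidComputer.PalasekTowerRegisterGlobalEnvelopeAt
import Summits.NavierStokesRegularity.FluidComputer.PalasekTowerRegisterGlobalKatoWindow
import Summits.NavierStokesRegularity.FluidComputer.PalasekTowerRegisterPushBudget
import Literature.Analysis.FluidPDE.ClassicalSolutionRescale
import Literature.Analysis.FluidPDE.RieszKernelBounds

/-!
# REGISTER v2.3′: the upper stubs of BOTH child cruxes reduce to ONE scale-free number —
# the universal sup-norm AMPLIFICATION bound of free finite-energy Navier–Stokes flow

Cell `ns-blowup`, seat `ns-blowup-ecbridge-1` (g7; holder-of-record of crux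
stmt-NavierStokesRegularity-19249 `HeredityAtOne`, registered line `Cruxes/HeredityAtOne/Lines/birth.lean`
v3, upper stub `stub_apriori_ceiling_at_one : AprioriCeilingAt 1`; the same predicate at the generic
levels is the upper stub `AprioriCeiling` of stmt-NavierStokesRegularity-19250 `HeredityFromTwo`).
Companion of `PalasekTowerRegisterGlobalEnvelopeAt.lean` (ecbridge-7: `AprioriCeilingAt k`),
`PalasekTowerRegisterGlobalCeiling.lean` (ecbridge-5: `AprioriCeiling`) and
`PalasekTowerRegisterGlobalKatoWindow.lean` (ecbridge-8: the Kato/Leray sub-window is overshoot-free).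
LABEL: E–C typing (KERNEL: one register-free predicate with parameters, PROVED reductions, the one
PROVED instance). WHAT THIS IS NOT: not Navier–Stokes evidence — nothing is constructed, no stage or
flow is claimed to exist, and `SupGrowthBound ν A T M` is asserted only on Leray's short window.

## The predicate

`SupGrowthBound ν A T M` («amplification at most `M` within time `T` from sup-level `A`»): every
UNFORCED classical solution `(u, p)` of the Navier–Stokes system at viscosity `ν` on a closed slab
`[0, T'] × ℝ³`, `0 < T' ≤ T`, with finite energy (`sup_t ∫|u|² < ∞`) and `|u(0, ·)| ≤ A` everywhere,
satisfies `|u(t, x)| ≤ M · A` on `[0, T'] × ℝ³`. It is REGISTER-FREE (no schedule, stage, rates,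
ball or margin) and SCALE-COVARIANT (Leray's similarity `u ↦ αu(αγ t, γ x)`, `ν ↦ αν/γ`, maps the
class `(ν, A, T)` onto `(αν/γ, αA, T/(αγ))`; the invariant is the window in Kato units `T·A²/ν`).
By Leray 1934 §21 (tree theorem `exists_norm_le_two_mul_of_finiteEnergy`) it HOLDS with `M = 2` for
`T < c₀ν/A²` (§2); for long windows it is OPEN (it fails for some `T` iff finite-energy classical
flows can amplify their sup by more than `M` — for every `M` if there is blow-up from bounded smooth
finite-energy data).

## The reductions (§3; every `k ≥ 1`, wide rates, registered constants `c₂ = 5/3`, `c₅ = 4bβ`)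

`aprioriCeilingAt_of_supGrowthBound`:
  `SupGrowthBound 1 ((5/3)·Y_k) (wide.window k) M → M·((5/3)·Y_k) ≤ (5/3)·Y_{k+1} → AprioriCeilingAt k`,
in particular with `M = Y_{k+1}/Y_k = N_k^{(b−1)(β−1)} = N_k^{0.13}` (`…_ratio`); at `k = 1` this is
the UPPER STUB of 19249 (`aprioriCeilingAt_one_of_supGrowthBound`), and over `k ≥ 2` the upper stub
`AprioriCeiling` of 19250 (`aprioriCeiling_of_supGrowthBound`). Proof: on `[0, τ_k]` a continuation IS
the stage (ceiling `c₂Y_k ≤ c₂Y_{k+1}`); past `τ_k` the design force is silent (`Quiet`, `k ≥ 1`), the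
translate by `τ_k` is an unforced finite-energy classical solution on `[0, T' − τ_k]`,
`T' − τ_k ≤ τ_{k+1} − τ_k = wide.window k` (`Schedule.Rigid.gap_eq_window`), starting below `c₂Y_k`.
So the upper stubs follow from a statement that never mentions the register: in Kato units
(§4, `window_mul_ceiling_sq_eq`) «free finite-energy classical flow does not amplify its sup by the
factor `N_k^{0.13}` within `Θ_k = (25/9)·4bβ·log N_{k+1}·N_k^{β−2}` sup-norm scaling times»
(`Θ_1 ≈ 1.18·10³`, `Θ_2 ≈ 1.55·10³`, factor `2.21` / `2.39`). The converse is NOT claimed: the stubs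
quantify over registered stages only. READING (planner / DNS seats): a numerical LOWER bound
`G(Θ_1) > 2.21` for the amplification function `G(T) := sup{‖u(t)‖_∞ : t ≤ T, ‖u(0)‖_∞ ≤ 1, ν = 1}`
(one strained fat vortex tube suffices to estimate it) would show that NO universal bound delivers the
upper stub — it would then be a bet on the registered class exactly like the floors; `G(Θ_1) ≤ 2.21`
would make the upper stub a pure-analysis target.

References: J. Leray, Acta Math. 63 (1934) §20–§21 (3.15) [cite: Leray1934, §21 (3.15) p. 226];
W. S. Ożański, B. C. Pooley, LMS LN 452 (2018) Lemma 6.23 (i) [cite: OzanskiPooley2018, Lemma 6.23 (i)];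
S. Palasek, arXiv:2605.13827 §3.3–§4 [cite: Palasek2026ElementaryModel, §4].
-/

noncomputable section

namespace Summit.NavierStokesRegularity.FluidComputer.PalasekTowerClayBridge

open Set MeasureTheory Filter Topology Function Real
open scoped ENNReal ContDiff NNReal
open Literature.Analysis.FluidPDE

/-! ## §1 The register-free predicate -/

/-- **Universal sup-norm amplification bound** (register-free; OPEN beyond Leray's window, never
asserted there): at viscosity `ν`, every UNFORCED classical solution `(u, p)` on a closed slab
`[0, T'] × ℝ³` with `0 < T' ≤ T`, of finite energy, with `|u(0, x)| ≤ A` for all `x`, satisfies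
`|u(t, x)| ≤ M · A` for all `t ∈ [0, T']` and all `x`. [cite: Leray1934, §21 (3.15) p. 226] -/
@[conjecture] def SupGrowthBound (ν A T M : ℝ) : Prop :=
  ∀ ⦃T' : ℝ⦄, 0 < T' → T' ≤ T →
    ∀ (u : ℝ → EuclideanSpace ℝ (Fin 3) → EuclideanSpace ℝ (Fin 3))
      (p : ℝ → EuclideanSpace ℝ (Fin 3) → ℝ),
      IsClassicalNSSolutionOn (Icc 0 T') ν 0 u p →
      (∃ C : ℝ≥0∞, C < ⊤ ∧ ∀ t ∈ Icc 0 T', ∫⁻ x, ‖u t x‖ₑ ^ 2 ≤ C) →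
      (∀ x, ‖u 0 x‖ ≤ A) →
      ∀ t ∈ Icc 0 T', ∀ x, ‖u t x‖ ≤ M * A

namespace SupGrowthBound

variable {ν A T M : ℝ}

/-- Shorter windows inherit the bound. [folklore] -/
theorem mono_time {T₁ : ℝ} (h : SupGrowthBound ν A T M) (hT : T₁ ≤ T) : SupGrowthBound ν A T₁ M :=
  fun _ hT' hT'T u p hu hE h0 => h hT' (hT'T.trans hT) u p hu hE h0

/-- Larger factors inherit the bound (for a nonnegative level `A`). [folklore] -/
theorem mono_factor {M₁ : ℝ} (h : SupGrowthBound ν A T M) (hA : 0 ≤ A) (hM : M ≤ M₁) :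
    SupGrowthBound ν A T M₁ :=
  fun _ hT' hT'T u p hu hE h0 t ht x =>
    (h hT' hT'T u p hu hE h0 t ht x).trans (mul_le_mul_of_nonneg_right hM hA)

/-- A nonpositive window carries no solution slab: the bound is vacuous. [folklore] -/
theorem of_nonpos (hT : T ≤ 0) : SupGrowthBound ν A T M :=
  fun _ hT' hT'T => absurd (hT'.trans_le (hT'T.trans hT)) (lt_irrefl 0)

/-- The factor is at least `1` as soon as the class is inhabited by a flow attaining the level `A`
at time `0` somewhere — recorded in the weak form every user needs: the bound at `t = 0` itself
is `A ≤ M · A` wherever `|u(0, x)| = A`. [folklore] -/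
theorem le_at_zero (h : SupGrowthBound ν A T M) {T' : ℝ} (hT' : 0 < T') (hT'T : T' ≤ T)
    {u : ℝ → EuclideanSpace ℝ (Fin 3) → EuclideanSpace ℝ (Fin 3)}
    {p : ℝ → EuclideanSpace ℝ (Fin 3) → ℝ} (hu : IsClassicalNSSolutionOn (Icc 0 T') ν 0 u p)
    (hE : ∃ C : ℝ≥0∞, C < ⊤ ∧ ∀ t ∈ Icc 0 T', ∫⁻ x, ‖u t x‖ₑ ^ 2 ≤ C) (h0 : ∀ x, ‖u 0 x‖ ≤ A)
    (x : EuclideanSpace ℝ (Fin 3)) : ‖u 0 x‖ ≤ M * A :=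
  h hT' hT'T u p hu hE h0 0 ⟨le_rfl, hT'.le⟩ x

end SupGrowthBound

/-! ## §2 The one proved instance: Leray's short window (`M = 2`, `T < c₀ν/A²`) -/

/-- **Leray 1934 §21 (3.15) as an amplification bound**: there is a universal `c₀ > 0` such that
`SupGrowthBound ν A T 2` holds whenever `0 < ν`, `0 < A` and `T < c₀ ν / A²` — the tree theorem
`exists_norm_le_two_mul_of_finiteEnergy` (Ożański–Pooley's finite-energy form of Leray's bound),
read through the predicate. This is the ONLY window on which the predicate is a theorem here.
[cite: Leray1934, §21 (3.15) p. 226] [cite: OzanskiPooley2018, Lemma 6.23 (i)] -/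
theorem exists_supGrowthBound_two :
    ∃ c₀ : ℝ, 0 < c₀ ∧ ∀ {ν A T : ℝ}, 0 < ν → 0 < A → T < c₀ * ν / A ^ 2 →
      SupGrowthBound ν A T 2 := by
  obtain ⟨c₀, hc₀, h⟩ := exists_norm_le_two_mul_of_finiteEnergy
  refine ⟨c₀, hc₀, ?_⟩
  intro ν A T hν hA hT T' hT' hT'T u p hu hE h0 t ht x
  exact h hν hT' hu hE hA h0 t ht (lt_of_le_of_lt (ht.2.trans hT'T) hT) x

/-! ## §3 The reductions: `AprioriCeilingAt k` (all `k ≥ 1`) and `AprioriCeiling` from the predicate -/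

/-- **THE REDUCTION at level `k ≥ 1`.** If free finite-energy classical flow at unit viscosity,
started below the registered level-`k` ceiling `(5/3)·Y_k`, cannot exceed `M·(5/3)·Y_k` within the
rigid window `wide.window k = 4bβ·log N_{k+1}/A_k`, and `M·(5/3)·Y_k ≤ (5/3)·Y_{k+1}`, then the
a-priori ceiling at level `k` holds: no finite-energy classical continuation of any registered
level-`k` stage of any pinned rigid quiet wide schedule exceeds `c₂Y_{k+1}` before `τ_{k+1}`.
(On `[0, τ_k]` the continuation is the stage, inside `c₂Y_k ≤ c₂Y_{k+1}`; past `τ_k` the force is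
silent, the translate by `τ_k` is unforced, finite-energy, classical on `[0, T' − τ_k]`,
`T' − τ_k ≤ wide.window k`, and starts below `c₂Y_k = (5/3)Y_k`.) The pins, the anchor, the floors
and the pressure agreement are not used. [cite: Palasek2026ElementaryModel, §4] -/
theorem aprioriCeilingAt_of_supGrowthBound {k : ℕ} (hk : 1 ≤ k) {M : ℝ}
    (h : SupGrowthBound 1 (5 / 3 * TowerRates.wide.Y k) (TowerRates.wide.window k) M)
    (hM : M * (5 / 3 * TowerRates.wide.Y k) ≤ 5 / 3 * TowerRates.wide.Y (k + 1)) :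
    AprioriCeilingAt k := by
  intro S _ hR hQ s T' hT' u p hu hagree hE t ht x
  have hc₂ : S.c₂ = 5 / 3 := hR.c₂_eq
  have hτk : 0 < S.τ k := S.τ_pos k
  have hYk : 0 < TowerRates.wide.Y k := Real.rpow_pos_of_pos (TowerRates.wide.N_pos k) _
  rcases le_or_gt t (S.τ k) with htk | htk
  · -- on `[0, τ_k]`: the stage's own ceiling, below the next one
    rw [(hagree t ⟨ht.1, htk⟩).1]
    have hce := s.ceiling k le_rfl t ⟨ht.1, htk⟩ x
    have hmono : S.c₂ * TowerRates.wide.Y k ≤ S.c₂ * TowerRates.wide.Y (k + 1) := by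
      rw [hc₂]
      exact mul_le_mul_of_nonneg_left (TowerRates.wide.Y_le_Y_succ k) (by norm_num)
    exact hce.trans hmono
  · -- past `τ_k`: translate by `τ_k`; the force is silent there (`Quiet`, `τ_1 ≤ τ_k`)
    have hτT' : S.τ k < T' := lt_of_lt_of_le htk ht.2
    have hf : ∀ r, S.τ k ≤ r → S.f r = 0 := fun r hr => hQ r ((S.τ_mono hk).trans hr)
    have hU : IsClassicalNSSolutionOn (Icc 0 (T' - S.τ k)) 1 0 (fun r => u (r + S.τ k))
        (fun r => p (r + S.τ k)) :=
      isClassicalNSSolutionOn_translate_of_silent hu hτk.le hτT' hf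
    have hEU : ∃ C : ℝ≥0∞, C < ⊤ ∧ ∀ r ∈ Icc 0 (T' - S.τ k), ∫⁻ y, ‖u (r + S.τ k) y‖ₑ ^ 2 ≤ C := by
      obtain ⟨C, hC, hb⟩ := hE
      exact ⟨C, hC, fun r hr => hb (r + S.τ k) ⟨by linarith [hr.1], by linarith [hr.2]⟩⟩
    have hU0 : ∀ y, ‖(fun r => u (r + S.τ k)) 0 y‖ ≤ 5 / 3 * TowerRates.wide.Y k := by
      intro y
      simp only [zero_add]
      rw [(hagree (S.τ k) ⟨hτk.le, le_rfl⟩).1, ← hc₂]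
      exact s.ceiling k le_rfl (S.τ k) ⟨hτk.le, le_rfl⟩ y
    have hlen : T' - S.τ k ≤ TowerRates.wide.window k := by
      rw [← hR.gap_eq_window k]
      linarith [hT'.2]
    have key := h (by linarith) hlen _ _ hU hEU hU0 (t - S.τ k) ⟨by linarith, by linarith [ht.2]⟩ x
    simp only [sub_add_cancel] at key
    rw [hc₂]
    exact key.trans hM

/-- **The reduction with the registered factor `Y_{k+1}/Y_k`** (`= N_k^{(b−1)(β−1)} = N_k^{0.13}` on
the wide rates): `SupGrowthBound 1 ((5/3)·Y_k) (wide.window k) (Y_{k+1}/Y_k) → AprioriCeilingAt k`,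
every `k ≥ 1`. [cite: Palasek2026ElementaryModel, §4] -/
theorem aprioriCeilingAt_of_supGrowthBound_ratio {k : ℕ} (hk : 1 ≤ k)
    (h : SupGrowthBound 1 (5 / 3 * TowerRates.wide.Y k) (TowerRates.wide.window k)
      (TowerRates.wide.Y (k + 1) / TowerRates.wide.Y k)) :
    AprioriCeilingAt k := by
  have hYk : 0 < TowerRates.wide.Y k := Real.rpow_pos_of_pos (TowerRates.wide.N_pos k) _
  refine aprioriCeilingAt_of_supGrowthBound hk h (le_of_eq ?_)
  field_simp

/-- **The upper stub of item 19249 from the predicate** (`k = 1`: the hand-over `1 → 2`,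
`(5/3)·Y₁ ≈ 4.63·10³`, window `4bβ·log N₂/A₁ ≈ 5.5·10⁻⁵`, factor `Y₂/Y₁ = N₁^{0.13} ≈ 2.21`):
`SupGrowthBound 1 ((5/3)·Y₁) (wide.window 1) (Y₂/Y₁) → AprioriCeilingAt 1`.
[cite: Palasek2026ElementaryModel, §4] -/
theorem aprioriCeilingAt_one_of_supGrowthBound
    (h : SupGrowthBound 1 (5 / 3 * TowerRates.wide.Y 1) (TowerRates.wide.window 1)
      (TowerRates.wide.Y 2 / TowerRates.wide.Y 1)) :
    AprioriCeilingAt 1 :=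
  aprioriCeilingAt_of_supGrowthBound_ratio le_rfl h

/-- **The upper stub of item 19250 from the predicate at the generic levels**: if the bound holds
with the registered factor at every `k ≥ 2`, then `AprioriCeiling`. [cite: Palasek2026ElementaryModel, §4] -/
theorem aprioriCeiling_of_supGrowthBound
    (h : ∀ k : ℕ, 2 ≤ k → SupGrowthBound 1 (5 / 3 * TowerRates.wide.Y k) (TowerRates.wide.window k)
      (TowerRates.wide.Y (k + 1) / TowerRates.wide.Y k)) :
    AprioriCeiling := by
  intro S hP hR hQ k hk s T' hT' u p hu hagree hE t ht x
  exact aprioriCeilingAt_of_supGrowthBound_ratio (by omega) (h k hk) S hP hR hQ s T' hT' u p hu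
    hagree hE t ht x

/-- **Both upper stubs at once**: the bound with the registered factor at every level `k ≥ 1` gives
`AprioriCeilingAt k` for every `k ≥ 1` (the upper halves of `HeredityAtOne`, `HeredityFromTwo` and of
every `HeredityAt k`). [cite: Palasek2026ElementaryModel, §4] -/
theorem aprioriCeilingAt_all_of_supGrowthBound
    (h : ∀ k : ℕ, 1 ≤ k → SupGrowthBound 1 (5 / 3 * TowerRates.wide.Y k) (TowerRates.wide.window k)
      (TowerRates.wide.Y (k + 1) / TowerRates.wide.Y k)) :
    ∀ k : ℕ, 1 ≤ k → AprioriCeilingAt k :=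
  fun k hk => aprioriCeilingAt_of_supGrowthBound_ratio hk (h k hk)

/-- **What Leray's window gives inside the register** (cross-check with ecbridge-8's
`exists_norm_le_ceiling_of_kato_window`, here as an instance of the reduction): there is a universal
`c₀ > 0` such that, IF the rigid window at level `k ≥ 1` were shorter than `c₀/((5/3)Y_k)²`, the
a-priori ceiling at level `k` would hold outright (factor `2 ≤ Y_{k+1}/Y_k` on the wide rates,
`TowerRates.wide_sep`). The hypothesis is FALSE on the wide rates (the window is `≈ 10³` Kato units,
§4) — the lemma records exactly what the only proved instance would need. [cite: Leray1934, §21 (3.15) p. 226] -/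
theorem exists_aprioriCeilingAt_of_short_window :
    ∃ c₀ : ℝ, 0 < c₀ ∧ ∀ k : ℕ, 1 ≤ k →
      TowerRates.wide.window k < c₀ / (5 / 3 * TowerRates.wide.Y k) ^ 2 → AprioriCeilingAt k := by
  obtain ⟨c₀, hc₀, h⟩ := exists_supGrowthBound_two
  refine ⟨c₀, hc₀, fun k hk hw => ?_⟩
  have hYk : 0 < TowerRates.wide.Y k := Real.rpow_pos_of_pos (TowerRates.wide.N_pos k) _
  have hA : 0 < 5 / 3 * TowerRates.wide.Y k := by positivity
  have hw' : TowerRates.wide.window k < c₀ * 1 / (5 / 3 * TowerRates.wide.Y k) ^ 2 := by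
    rwa [mul_one]
  refine aprioriCeilingAt_of_supGrowthBound hk (h one_pos hA hw') ?_
  have hsep := TowerRates.wide_sep k
  nlinarith

/-! ## §4 The number: the rigid window in Kato units of the ceiling speed -/

/-- **The window in Kato units.** `wide.window k · ((5/3)·Y_k)² = (25/9)·4bβ·log N_{k+1}·N_k^{β−2}` —
the scale-invariant length of the level-`k` growth window measured in sup-norm scaling times
`ν/(c₂Y_k)²` of the ceiling speed (register-free form of ecbridge-8's
`Schedule.Rigid.window_mul_ceiling_sq`; `≈ 1.18·10³` at `k = 1`, `≈ 1.55·10³` at `k = 2`, unbounded in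
`k` since `β > 2`). This is the `T·A²/ν` at which §3 consumes the predicate. [folklore] -/
theorem window_mul_ceiling_sq_eq (k : ℕ) :
    TowerRates.wide.window k * (5 / 3 * TowerRates.wide.Y k) ^ 2 =
      25 / 9 * (4 * TowerRates.wide.b * TowerRates.wide.β) *
        Real.log (TowerRates.wide.N (k + 1)) * TowerRates.wide.N k ^ (TowerRates.wide.β - 2) := by
  have hN : 0 < TowerRates.wide.N k := TowerRates.wide.N_pos k
  unfold TowerRates.window TowerRates.Y TowerRates.A
  have h2 : (TowerRates.wide.N k ^ (TowerRates.wide.β - 1)) ^ 2 =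
      TowerRates.wide.N k ^ TowerRates.wide.β * TowerRates.wide.N k ^ (TowerRates.wide.β - 2) := by
    rw [← Real.rpow_natCast, ← Real.rpow_mul hN.le, ← Real.rpow_add hN]
    congr 1
    push_cast
    ring
  have hA : TowerRates.wide.N k ^ TowerRates.wide.β ≠ 0 := (Real.rpow_pos_of_pos hN _).ne'
  rw [mul_pow, h2]
  field_simp
  ring

/-- **The factor in exponent form**: `Y_{k+1}/Y_k = N_k^{(b−1)(β−1)}` (`= N_k^{13/100}` on the wide
rates: `2.21` at `k = 1`, `2.39` at `k = 2`). [cite: Palasek2026ElementaryModel, §1.2] -/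
theorem wide_Y_ratio_eq (k : ℕ) :
    TowerRates.wide.Y (k + 1) / TowerRates.wide.Y k =
      TowerRates.wide.N k ^ ((TowerRates.wide.b - 1) * (TowerRates.wide.β - 1)) := by
  have hYk : 0 < TowerRates.wide.Y k := Real.rpow_pos_of_pos (TowerRates.wide.N_pos k) _
  rw [TowerRates.wide.Y_succ k]
  field_simp

/-! ## §5 Scale covariance: the predicate depends on `(ν, A, T)` only through `T·A²/ν` -/

/-- **Leray's similarity transports the predicate between scales.** If the bound holds at
`(ν, A, T)` with factor `M`, it holds at every `(ν', A', T')` with `T'·A'²/ν' ≤ T·A²/ν` (same `M`):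
given an unforced finite-energy classical `(u, p)` at viscosity `ν'` on `[0, T₁]`, `T₁ ≤ T'`, started
below `A'`, the pair `w = α u(β s, γ y)`, `q = α² p(β s, γ y)` with `α = A/A'`, `γ = αν'/ν`, `β = αγ`
(`IsClassicalNSSolutionOn.stRescale`) is unforced, classical at viscosity `ν` on `[0, T₁/β]`,
`T₁/β ≤ T`, of finite energy (`∫|w(s)|² = α²γ⁻³∫|u(βs)|²`), started below `A`; the bound for `w`
at `(t/β, x/γ)` is the bound for `u` at `(t, x)`. [cite: Leray1934, §20] -/
theorem SupGrowthBound.rescale {ν A T M ν' A' T' : ℝ} (h : SupGrowthBound ν A T M)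
    (hν : 0 < ν) (hA : 0 < A) (hν' : 0 < ν') (hA' : 0 < A')
    (hT : T' * A' ^ 2 / ν' ≤ T * A ^ 2 / ν) : SupGrowthBound ν' A' T' M := by
  intro T₁ hT₁ hT₁T u p hu hE h0 t ht x
  -- the similarity parameters
  set α : ℝ := A / A' with hα
  set γ : ℝ := α * ν' / ν with hγ
  set β : ℝ := α * γ with hβ
  have hα0 : 0 < α := div_pos hA hA'
  have hγ0 : 0 < γ := by positivity
  have hβ0 : 0 < β := mul_pos hα0 hγ0
  have hαA : α * A' = A := by rw [hα]; field_simp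
  have hβe : β = A ^ 2 * ν' / (A' ^ 2 * ν) := by
    rw [hβ, hγ, hα]; field_simp
  -- the rescaled pair is an unforced classical solution at viscosity `ν` on `[0, T₁/β]`
  have hw₀ := hu.stRescale hα0 hγ0 hβ 0 (0 : EuclideanSpace ℝ (Fin 3))
  have hvisc : α * ν' / γ = ν := by rw [hγ]; field_simp
  rw [hvisc, smul_stPull_zero] at hw₀
  have hT₁β : 0 < T₁ / β := div_pos hT₁ hβ0
  have hsub : Icc (0 : ℝ) (T₁ / β) ⊆ (fun r => (0 : ℝ) + β * r) ⁻¹' Icc 0 T₁ := by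
    intro r hr
    simp only [mem_preimage, zero_add, mem_Icc]
    refine ⟨by nlinarith [hr.1], ?_⟩
    have := hr.2
    rwa [le_div_iff₀ hβ0, mul_comm] at this
  have hw : IsClassicalNSSolutionOn (Icc 0 (T₁ / β)) ν 0
      (α • stPull β γ 0 (0 : EuclideanSpace ℝ (Fin 3)) u)
      (α ^ 2 • stPull β γ 0 (0 : EuclideanSpace ℝ (Fin 3)) p) :=
    hw₀.mono hsub (uniqueDiffOn_Icc hT₁β)
  -- pointwise form of the rescaled velocity
  have hwval : ∀ s y, (α • stPull β γ 0 (0 : EuclideanSpace ℝ (Fin 3)) u) s y = α • u (β * s) (γ • y) := by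
    intro s y
    simp only [Pi.smul_apply, stPull_apply, zero_add]
  -- finite energy of the rescaled velocity
  have hEw : ∃ C : ℝ≥0∞, C < ⊤ ∧ ∀ s ∈ Icc 0 (T₁ / β),
      ∫⁻ y, ‖(α • stPull β γ 0 (0 : EuclideanSpace ℝ (Fin 3)) u) s y‖ₑ ^ 2 ≤ C := by
    obtain ⟨C, hC, hb⟩ := hE
    refine ⟨‖α‖ₑ ^ 2 * (ENNReal.ofReal (γ ^ 3)⁻¹ * C), ?_, fun s hs => ?_⟩
    · exact ENNReal.mul_lt_top (ENNReal.pow_lt_top enorm_lt_top)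
        (ENNReal.mul_lt_top ENNReal.ofReal_lt_top hC)
    · have hβs : β * s ∈ Icc 0 T₁ := hsub hs |>.elim fun h1 h2 => ⟨by simpa using h1, by simpa using h2⟩
      calc ∫⁻ y, ‖(α • stPull β γ 0 (0 : EuclideanSpace ℝ (Fin 3)) u) s y‖ₑ ^ 2
          = ∫⁻ y, ‖α‖ₑ ^ 2 * ‖u (β * s) (γ • y)‖ₑ ^ 2 := by
            refine lintegral_congr fun y => ?_
            rw [hwval, enorm_smul, mul_pow]
        _ = ‖α‖ₑ ^ 2 * ∫⁻ y, ‖u (β * s) (γ • y)‖ₑ ^ 2 :=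
            lintegral_const_mul' _ _ (ENNReal.pow_ne_top enorm_ne_top)
        _ = ‖α‖ₑ ^ 2 * (ENNReal.ofReal (γ ^ 3)⁻¹ * ∫⁻ y, ‖u (β * s) y‖ₑ ^ 2) := by
            rw [RieszKernel.lintegral_comp_smul (fun y => ‖u (β * s) y‖ₑ ^ 2) hγ0]
        _ ≤ ‖α‖ₑ ^ 2 * (ENNReal.ofReal (γ ^ 3)⁻¹ * C) := by
            gcongr
            exact hb (β * s) hβs
  -- the rescaled datum is below `A`
  have hw0 : ∀ y, ‖(α • stPull β γ 0 (0 : EuclideanSpace ℝ (Fin 3)) u) 0 y‖ ≤ A := by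
    intro y
    rw [hwval, mul_zero, norm_smul, Real.norm_eq_abs, abs_of_pos hα0, ← hαA]
    exact mul_le_mul_of_nonneg_left (h0 (γ • y)) hα0.le
  -- the rescaled window is inside `T`
  have hTβ : T₁ / β ≤ T := by
    have h1 : T₁ * A' ^ 2 / ν' ≤ T * A ^ 2 / ν := le_trans (by gcongr) hT
    have e : T₁ / β = (T₁ * A' ^ 2 / ν') * (ν / A ^ 2) := by
      rw [hβe]
      field_simp
    rw [e]
    calc (T₁ * A' ^ 2 / ν') * (ν / A ^ 2) ≤ (T * A ^ 2 / ν) * (ν / A ^ 2) := by gcongr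
      _ = T := by field_simp
  -- read the bound at `(t/β, x/γ)`
  have hs : t / β ∈ Icc 0 (T₁ / β) := ⟨div_nonneg ht.1 hβ0.le, by gcongr; exact ht.2⟩
  have key := h hT₁β hTβ _ _ hw hEw hw0 (t / β) hs (γ⁻¹ • x)
  rw [hwval, mul_div_cancel₀ _ hβ0.ne', smul_smul, mul_inv_cancel₀ hγ0.ne', one_smul, norm_smul,
    Real.norm_eq_abs, abs_of_pos hα0, ← hαA] at key
  have : α * ‖u t x‖ ≤ α * (M * A') := by linarith [key]
  exact le_of_mul_le_mul_left this hα0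

/-- **NORMAL FORM (Kato units).** For `ν, A > 0`:
`SupGrowthBound ν A T M ↔ SupGrowthBound 1 1 (T·A²/ν) M` — the predicate is a statement about ONE
number, the window `T·A²/ν` in sup-norm scaling times, and the factor `M`. [cite: Leray1934, §20] -/
theorem supGrowthBound_iff_unit {ν A T M : ℝ} (hν : 0 < ν) (hA : 0 < A) :
    SupGrowthBound ν A T M ↔ SupGrowthBound 1 1 (T * A ^ 2 / ν) M :=
  ⟨fun h => h.rescale hν hA one_pos one_pos (by simp),
    fun h => h.rescale one_pos one_pos hν hA (by simp)⟩

/-- **The upper stubs in Kato units.** For every `k ≥ 1`: if free finite-energy classical flow at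
unit viscosity started below sup-level `1` cannot amplify its sup by the factor
`N_k^{(b−1)(β−1)}` (`= N_k^{0.13}`) within `(25/9)·4bβ·log N_{k+1}·N_k^{β−2}` time units, then
`AprioriCeilingAt k` (at `k = 1`: factor `≈ 2.21` within `≈ 1.18·10³`; this is the register-free
content of the upper stub of item 19249). [cite: Palasek2026ElementaryModel, §4] -/
theorem aprioriCeilingAt_of_supGrowthBound_unit {k : ℕ} (hk : 1 ≤ k)
    (h : SupGrowthBound 1 1
      (25 / 9 * (4 * TowerRates.wide.b * TowerRates.wide.β) *
        Real.log (TowerRates.wide.N (k + 1)) * TowerRates.wide.N k ^ (TowerRates.wide.β - 2))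
      (TowerRates.wide.N k ^ ((TowerRates.wide.b - 1) * (TowerRates.wide.β - 1)))) :
    AprioriCeilingAt k := by
  have hYk : 0 < TowerRates.wide.Y k := Real.rpow_pos_of_pos (TowerRates.wide.N_pos k) _
  have hA : 0 < 5 / 3 * TowerRates.wide.Y k := by positivity
  rw [← window_mul_ceiling_sq_eq k, ← wide_Y_ratio_eq k, ← div_one (TowerRates.wide.window k * _)]
    at h
  exact aprioriCeilingAt_of_supGrowthBound_ratio hk ((supGrowthBound_iff_unit one_pos hA).2 h)

end Summit.NavierStokesRegularity.FluidComputer.PalasekTowerClayBridge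

end
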